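import Summits.ResolutionOfSingularities.ResolutionOfSingularities.Theorems.FrobeniusClosingPatchingRelPerfectCuspMember
import HarnessLib

/-!
# Crux `PatchingRelPerfect` (stmt-ResolutionOfSingularities-16161), chain w52 — kernel certificate of
# the NON-GRADED DEPTH-FOUR member `(x₃² + x₀³) + 𝔪⁶`, part 3a: the member, its `S`-avatars and
# their images on the Rees charts of `Bl_𝔪` (any ring)

[OURS · L1 W5.2 · kernel (iii) beyond F6, CHAIN v2.0 §1 (C)] The `S`-level data of the certificate
(note `NONGRADED-DEPTH4-MEMBER.md` §3, evidence #59; chart table kit j276688): for a family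
`x = (x₁, …, x_n)` of a ring `R` (the regular system of parameters in the application) and indices
`w = x_{iw}`, `z = x_{iz}`, the member `I = (z² + w³) + M⁶`, `M = (x)`, and the avatars
`𝔞_{L₁} = (w, z) + M²`, `𝔞_{Π₂} = (w²) + zM + M⁴`, `𝔞_{Σ̃} = (z) + wM + M³`,
`𝔅_{k+2} = ((z² + w³) w^{2k}) + z^{k+2} M^k + M^{4k+6}` (`k < 6`), companion
`Q₀ = 𝔞_{Π₂} · 𝔞_{Σ̃} · ∏_{k<6} 𝔅_{k+2} · 𝔞_{L₁} ⊇ M¹⁰⁵`.  On the Rees chart `D₊(x_i t)`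
(`u = x_i/1`, `c = z/x_i`, `a = w/x_i`):

* `map_member₆_mul_Q₀` — `(I · Q₀) · B_i = u⁴⁸ · (F(u, c, a) · (u, c, a))`, `F = P · Σ · K · ∏ B`
  the `y`-chart product of parts 1–2 (`CuspDepthFour.depthFour_isRegular`);
* `FS_a_one` — on the chart of `w` (`a = 1`) this is the tangent-Euclid product of
  `CoreRungTower.tangent_euclid_two 3` in `(u, c)`; `FS_c_one` — on the chart of `z` (`c = 1`) it is
  the unit ideal; `pow_le_Q₀₆` — `M¹⁰⁵ ≤ Q₀`.

Part 3b assembles the member over a regular local ring.  FORMAT evidence for the core on the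
`𝔪`-primary stratum; nothing here is a statement of the manuscript under review.

## References

* The Stacks Project, Tags 0804, 080A. [StacksProject]
-/

-- `Summit.<Summit>.<Sub>.Theorems` with `Sub = Summit` (single-conjunct summit, D-0017)
set_option linter.dupNamespace false

noncomputable section

open CategoryTheory CategoryTheory.Limits AlgebraicGeometry Literature.AlgebraicGeometry.Resolution
open scoped Pointwise nonZeroDivisors

namespace Summit.ResolutionOfSingularities.ResolutionOfSingularities.Theorems

universe u

namespace CuspDepthFour

/-! ## Notation: the `y`-chart factors (parts 1–2) -/

local notation3 "Pf[" t "," c "," a "]" => (Ideal.span {a ^ 2} ⊔ Ideal.span {c} ⊔ Ideal.span {t ^ 2})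
local notation3 "Sf[" t "," c "," a "]" => (Ideal.span {c} ⊔ Ideal.span {t * a} ⊔ Ideal.span {t ^ 2})
local notation3 "Kf[" t "," c "," a "]" => (Ideal.span {c ^ 2 + t * a ^ 3} ⊔ Ideal.span {t ^ 4})
local notation3 "Bf[" t "," c "," a "," k "]" =>
  (Ideal.span {a ^ (2 * k) * (c ^ 2 + t * a ^ 3)} ⊔ Ideal.span {c ^ (k + 2)} ⊔ Ideal.span {t ^ (2 * k + 4)})
local notation3 "Ff[" t "," c "," a "]" =>
  (Pf[t,c,a] * Sf[t,c,a] * Kf[t,c,a] * ∏ k ∈ Finset.range 6, Bf[t,c,a,k])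
/-- The full chart residual including the line `(u, c, a)`. -/
local notation3 "FS[" t "," c "," a "]" => (Ff[t,c,a] * Ideal.span (Set.range ![t, c, a]))
/-- The tangent-Euclid product of `CoreRungTower.tangent_euclid_two 3` (`η = 1`). -/
local notation3 "TE[" t "," c "]" =>
  (((Ideal.span {1 * t + c ^ 2} ⊔ Ideal.span {t ^ (3 + 1)}) *
    ∏ k ∈ Finset.range (2 * 3), (Ideal.span {1 * t + c ^ 2} ⊔ Ideal.span {c ^ (k + 2)})) *
    Ideal.span (Set.range ![t, c]))

section Algebra

variable {A : Type u} [CommRing A]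

/-- `Σ_{k<6} (2k+2) = 42`. [folklore] -/
theorem sum_range_six_two : ∑ k ∈ Finset.range 6, (2 * k + 2) = 42 := by decide

/-- Collecting the Cartier twist of the member's chart image. [folklore] -/
theorem collect_member₆ (u : A) (K P S L X : Ideal A) :
    Ideal.span {u ^ 2} * K * (Ideal.span {u ^ 2} * P * (Ideal.span {u} * S) * (Ideal.span {u ^ 42} * X) *
      (Ideal.span {u} * L)) = Ideal.span {u ^ 48} * (P * S * K * X * L) := by
  simp only [← Ideal.span_singleton_pow]
  ring

/-- `(a, c, u) = (u, c, a)`. [folklore] -/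
theorem span_acu (u c a : A) :
    Ideal.span {a} ⊔ Ideal.span {c} ⊔ Ideal.span {u} = Ideal.span (Set.range ![u, c, a]) := by
  rw [CuspMember.span_range_vec3]
  ac_rfl

/-! ### The chart of `w` (`a = 1`): the tangent-Euclid product -/

/-- `t^{2k+4} ∈ (t + c²) + (c^{k+2})`. [folklore] -/
theorem pow_mem_host_sup (t c : A) (k : ℕ) :
    t ^ (2 * k + 4) ∈ Ideal.span {1 * t + c ^ 2} ⊔ Ideal.span {c ^ (k + 2)} := by
  have e : t ^ (2 * k + 4) = (t ^ (2 * k + 4) - (-(c ^ 2)) ^ (2 * k + 4)) + (-(c ^ 2)) ^ (2 * k + 4) := by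
    ring
  rw [e]
  refine Submodule.add_mem _ (Ideal.mem_sup_left ?_) (Ideal.mem_sup_right ?_)
  · have hd := sub_dvd_pow_sub_pow t (-(c ^ 2)) (2 * k + 4)
    have e' : t - -(c ^ 2) = 1 * t + c ^ 2 := by ring
    rw [e'] at hd
    exact Ideal.mem_span_singleton.mpr hd
  · refine Ideal.mem_span_singleton.mpr ⟨(-1) ^ (2 * k + 4) * c ^ (3 * k + 6), ?_⟩
    ring

/-- **On the chart of `w` the residual is the tangent-Euclid product.** [folklore] -/
theorem FS_a_one (t c : A) : FS[t, c, (1 : A)] = TE[t, c] := by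
  have hP : Pf[t, c, (1 : A)] = ⊤ := by
    rw [one_pow, Ideal.span_singleton_one, top_sup_eq, top_sup_eq]
  have hS : Sf[t, c, (1 : A)] = Ideal.span (Set.range ![t, c]) := by
    rw [mul_one, CuspMember.span_range_vec2, sup_comm (Ideal.span {c}) (Ideal.span {t})]
    exact sup_eq_left.mpr (le_sup_of_le_left (Ideal.span_singleton_le_span_singleton.mpr ⟨t, by ring⟩))
  have hK : Kf[t, c, (1 : A)] = Ideal.span {1 * t + c ^ 2} ⊔ Ideal.span {t ^ (3 + 1)} := by
    have e1 : c ^ 2 + t * (1 : A) ^ 3 = 1 * t + c ^ 2 := by ring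
    rw [e1]
  have hB : ∀ k : ℕ, Bf[t, c, (1 : A), k] = Ideal.span {1 * t + c ^ 2} ⊔ Ideal.span {c ^ (k + 2)} := by
    intro k
    have e1 : (1 : A) ^ (2 * k) * (c ^ 2 + t * 1 ^ 3) = 1 * t + c ^ 2 := by ring
    rw [e1]
    exact sup_eq_left.mpr ((Ideal.span_singleton_le_iff_mem _).mpr (pow_mem_host_sup t c k))
  have hL : Ideal.span (Set.range ![t, c, (1 : A)]) = ⊤ := by
    rw [CuspMember.span_range_vec3, Ideal.span_singleton_one, sup_top_eq]
  simp_rw [hB]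
  rw [hP, hS, hK, hL, Ideal.top_mul, Ideal.mul_top]
  have e : Finset.range (2 * 3) = Finset.range 6 := rfl
  rw [e]
  ring

/-! ### The chart of `z` (`c = 1`): everything principal -/

/-- **On the chart of `z` the residual is the unit ideal.** [folklore] -/
theorem FS_c_one (t a : A) : FS[t, (1 : A), a] = ⊤ := by
  have hP : Pf[t, (1 : A), a] = ⊤ := by
    rw [Ideal.span_singleton_one, sup_top_eq, top_sup_eq]
  have hS : Sf[t, (1 : A), a] = ⊤ := by
    rw [Ideal.span_singleton_one, top_sup_eq, top_sup_eq]
  have hK : Kf[t, (1 : A), a] = ⊤ :=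
    CoreRungTower.eq_top_of_isUnit_eq_sub isUnit_one (h := (1 : A) ^ 2 + t * a ^ 3) (n := t * a ^ 3)
      (by ring) _ 1 4 (by rw [pow_one]; exact Ideal.mem_sup_left (Ideal.mem_span_singleton_self _))
      (Ideal.mem_sup_right (Ideal.mem_span_singleton.mpr ⟨a ^ 12, by ring⟩))
  have hB : ∀ k : ℕ, Bf[t, (1 : A), a, k] = ⊤ := fun k => by
    simp only [one_pow, Ideal.span_singleton_one, sup_top_eq, top_sup_eq]
  have hL : Ideal.span (Set.range ![t, (1 : A), a]) = ⊤ := by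
    rw [CuspMember.span_range_vec3, Ideal.span_singleton_one, sup_top_eq, top_sup_eq]
  simp_rw [hB]
  rw [hP, hS, hK, hL, Finset.prod_const, Ideal.top_pow, Ideal.top_mul, Ideal.top_mul, Ideal.top_mul,
    Ideal.top_mul]

end Algebra

/-! ## The member, its avatars, and their images on a Rees chart of `Bl_{(x)}` (any ring) -/

section Charts

variable {R : Type u} [CommRing R] {n : ℕ} (x : Fin n → R) (iw iz i : Fin n)

/-- `M = (x)`. -/
local notation3 "M" => Ideal.span (Set.range x)
/-- The member `I = (z² + w³) + M⁶`. -/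
local notation3 "II" => (Ideal.span {x iz ^ 2 + x iw ^ 3} ⊔ Ideal.span (Set.range x) ^ 6)
/-- `𝔞_{L₁} = (w) + (z) + M²`. -/
local notation3 "aL" => (Ideal.span {x iw} ⊔ Ideal.span {x iz} ⊔ Ideal.span (Set.range x) ^ 2)
/-- `𝔞_{Π₂} = (w²) + zM + M⁴`. -/
local notation3 "aP" => (Ideal.span {x iw ^ 2} ⊔ Ideal.span {x iz} * Ideal.span (Set.range x) ⊔
  Ideal.span (Set.range x) ^ 4)
/-- `𝔞_{Σ̃} = (z) + wM + M³`. -/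
local notation3 "aS" => (Ideal.span {x iz} ⊔ Ideal.span {x iw} * Ideal.span (Set.range x) ⊔
  Ideal.span (Set.range x) ^ 3)
/-- `𝔅_{k+2} = ((z² + w³) w^{2k}) + z^{k+2} M^k + M^{4k+6}`. -/
local notation3 "aB[" k "]" => (Ideal.span {x iw ^ (2 * k) * (x iz ^ 2 + x iw ^ 3)} ⊔
  Ideal.span {x iz ^ (k + 2)} * Ideal.span (Set.range x) ^ k ⊔ Ideal.span (Set.range x) ^ (4 * k + 6))
/-- The companion `Q₀ = 𝔞_{Π₂} · 𝔞_{Σ̃} · ∏ 𝔅 · 𝔞_{L₁}`. -/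
local notation3 "Q₀" => (aP * aS * (∏ k ∈ Finset.range 6, aB[k]) * aL)
local notation3 "φ" => chartBase x i
local notation3 "uu" => chartBase x i (x i)
local notation3 "cc" => chartGen x i iz
local notation3 "aa" => chartGen x i iw

/-- **The member on a chart**: `I · B_i = u² · ((c² + u a³) + (u⁴))`. [cite: StacksProject, Tag 0804] -/
theorem map_member₆ : (II).map φ = Ideal.span {uu ^ 2} * Kf[uu,cc,aa] := by
  rw [Ideal.map_sup, CuspMember.map_span_singleton, CuspMember.map_M_pow, map_add, map_pow, map_pow,
    reesChartBase_apply_eq_mul_chartGen x i iz, reesChartBase_apply_eq_mul_chartGen x i iw]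
  have e1 : (uu * cc) ^ 2 + (uu * aa) ^ 3 = uu ^ 2 * (cc ^ 2 + uu * aa ^ 3) := by ring
  have e2 : uu ^ 6 = uu ^ 2 * uu ^ 4 := by ring
  rw [e1, e2, Ideal.mul_sup, Ideal.span_singleton_mul_span_singleton, Ideal.span_singleton_mul_span_singleton]

/-- `𝔞_{L₁} · B_i = u · (u, c, a)`. [cite: StacksProject, Tag 0804] -/
theorem map_aL₆ : (aL).map φ = Ideal.span {uu} * Ideal.span (Set.range ![uu, cc, aa]) := by
  rw [Ideal.map_sup, Ideal.map_sup, CuspMember.map_span_singleton, CuspMember.map_span_singleton,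
    CuspMember.map_M_pow, reesChartBase_apply_eq_mul_chartGen x i iz,
    reesChartBase_apply_eq_mul_chartGen x i iw, ← span_acu, Ideal.mul_sup, Ideal.mul_sup,
    Ideal.span_singleton_mul_span_singleton, Ideal.span_singleton_mul_span_singleton,
    Ideal.span_singleton_mul_span_singleton]
  have e1 : uu ^ 2 = uu * uu := by ring
  rw [e1]

/-- `M · B_i = (u)`. [cite: StacksProject, Tag 0804] -/
theorem map_M_one : (M).map φ = Ideal.span {uu} :=
  map_reesChartBase_eq (x i) (Ideal.mem_span_range_self (f := x) (x := i))

/-- `𝔞_{Π₂} · B_i = u² · (a², c, u²)`. [cite: StacksProject, Tag 0804] -/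
theorem map_aP : (aP).map φ = Ideal.span {uu ^ 2} * Pf[uu,cc,aa] := by
  rw [Ideal.map_sup, Ideal.map_sup, Ideal.map_mul, CuspMember.map_span_singleton,
    CuspMember.map_span_singleton, map_M_one, CuspMember.map_M_pow, map_pow,
    reesChartBase_apply_eq_mul_chartGen x i iz, reesChartBase_apply_eq_mul_chartGen x i iw,
    Ideal.span_singleton_mul_span_singleton]
  rw [Ideal.mul_sup, Ideal.mul_sup, Ideal.span_singleton_mul_span_singleton,
    Ideal.span_singleton_mul_span_singleton, Ideal.span_singleton_mul_span_singleton]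
  have e1 : (uu * aa) ^ 2 = uu ^ 2 * aa ^ 2 := by ring
  have e2 : uu * cc * uu = uu ^ 2 * cc := by ring
  have e3 : uu ^ 4 = uu ^ 2 * uu ^ 2 := by ring
  rw [e1, e2, e3]

/-- `𝔞_{Σ̃} · B_i = u · (c, u a, u²)`. [cite: StacksProject, Tag 0804] -/
theorem map_aS₆ : (aS).map φ = Ideal.span {uu} * Sf[uu,cc,aa] := by
  rw [Ideal.map_sup, Ideal.map_sup, Ideal.map_mul, CuspMember.map_span_singleton,
    CuspMember.map_span_singleton, map_M_one, CuspMember.map_M_pow,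
    reesChartBase_apply_eq_mul_chartGen x i iz, reesChartBase_apply_eq_mul_chartGen x i iw,
    Ideal.span_singleton_mul_span_singleton]
  rw [Ideal.mul_sup, Ideal.mul_sup, Ideal.span_singleton_mul_span_singleton,
    Ideal.span_singleton_mul_span_singleton, Ideal.span_singleton_mul_span_singleton]
  have e2 : uu * aa * uu = uu * (uu * aa) := by ring
  have e3 : uu ^ 3 = uu * uu ^ 2 := by ring
  rw [e2, e3]

/-- `𝔅_{k+2} · B_i = u^{2k+2} · ((a^{2k}(c² + u a³)) + (c^{k+2}) + (u^{2k+4}))`.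
[cite: StacksProject, Tag 0804] -/
theorem map_aB (k : ℕ) : (aB[k]).map φ = Ideal.span {uu ^ (2 * k + 2)} * Bf[uu,cc,aa,k] := by
  rw [Ideal.map_sup, Ideal.map_sup, Ideal.map_mul, CuspMember.map_span_singleton,
    CuspMember.map_span_singleton, CuspMember.map_M_pow, CuspMember.map_M_pow, map_mul, map_pow, map_add,
    map_pow, map_pow, map_pow, reesChartBase_apply_eq_mul_chartGen x i iz,
    reesChartBase_apply_eq_mul_chartGen x i iw, Ideal.span_singleton_mul_span_singleton]
  rw [Ideal.mul_sup, Ideal.mul_sup, Ideal.span_singleton_mul_span_singleton,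
    Ideal.span_singleton_mul_span_singleton, Ideal.span_singleton_mul_span_singleton]
  have e1 : (uu * aa) ^ (2 * k) * ((uu * cc) ^ 2 + (uu * aa) ^ 3) =
      uu ^ (2 * k + 2) * (aa ^ (2 * k) * (cc ^ 2 + uu * aa ^ 3)) := by ring
  have e2 : (uu * cc) ^ (k + 2) * uu ^ k = uu ^ (2 * k + 2) * cc ^ (k + 2) := by ring
  have e3 : uu ^ (4 * k + 6) = uu ^ (2 * k + 2) * uu ^ (2 * k + 4) := by ring
  rw [e1, e2, e3]

set_option maxHeartbeats 400000 in
-- instance-path defeq through `HomogeneousLocalization`'s standalone `Pow`/`Mul` (as in p508825)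
/-- **THE CHART IMAGE OF `I · Q₀`** on every Rees chart `D₊(x_i t)` of `Bl_M Spec R`:
`(I Q₀) B_i = u⁴⁸ · (F(u, z/x_i, w/x_i) · (u, z/x_i, w/x_i))`. [cite: StacksProject, Tag 0804] -/
theorem map_member₆_mul_Q₀ : (II * Q₀).map φ = Ideal.span {uu ^ 48} * FS[uu,cc,aa] := by
  rw [Ideal.map_mul, Ideal.map_mul, Ideal.map_mul, Ideal.map_mul, CoreRungTower.map_prod_range,
    map_member₆, map_aP, map_aS₆, map_aL₆]
  simp_rw [map_aB]
  rw [Finset.prod_mul_distrib, Ideal.prod_span_singleton, Finset.prod_pow_eq_pow_sum, sum_range_six_two]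
  exact collect_member₆ _ _ _ _ _ _

/-- `Q₀ ⊇ M¹⁰⁵`. [folklore] -/
theorem pow_le_Q₀₆ : M ^ 105 ≤ Q₀ := by
  have hB : ∀ k : ℕ, M ^ (4 * k + 6) ≤ aB[k] := fun k => le_sup_right
  have hprod : M ^ 96 ≤ ∏ k ∈ Finset.range 6, aB[k] := by
    have e : (96 : ℕ) = ∑ k ∈ Finset.range 6, (4 * k + 6) := by decide
    rw [e, ← Finset.prod_pow_eq_pow_sum]
    exact Finset.prod_le_prod' fun k _ => hB k
  have hP : M ^ 4 ≤ aP := le_sup_right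
  have hS : M ^ 3 ≤ aS := le_sup_right
  have hL : M ^ 2 ≤ aL := le_sup_right
  rw [show (105 : ℕ) = 4 + 3 + 96 + 2 from rfl, pow_add, pow_add, pow_add]
  exact Ideal.mul_mono (Ideal.mul_mono (Ideal.mul_mono hP hS) hprod) hL

end Charts

end CuspDepthFour

end Summit.ResolutionOfSingularities.ResolutionOfSingularities.Theorems

end
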